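import Mathlib

/-!
# Crux `ExactCertificate` (stmt-AtomisticToContinuum-11959), line `closure-makes-nogap-exact`,
# skeleton IX (`FarSlackActive`): stub `stub_fourierEntireReal` (F0)

Support file for the crux `ThreeConeCertificate.ExactCertificate`, skeleton IX
(`Cruxes.ExactCertificate.FarEqual.FarSlackActive`: the slack cone of an exact three-cone
certificate is active beyond every radius).  That skeleton shows that the Fourier slice of the
certificate kernel is an entire function of exponential type vanishing at superlinearly many
lattice norms; the plank profile `x ↦ ∫_{ℝ²} G (x, y) dy` of the explicit far part `G` is a
one-variable integrable function, and this file supplies the one-dimensional easy half of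
Paley–Wiener used for it: for an integrable `p : ℝ → ℂ` vanishing off `[-L, L]`,

  `Φ z := ∫ x, exp (-2π i z x) p x`

* is entire: differentiation under the integral sign
  (`hasDerivAt_integral_of_dominated_loc_of_deriv_le` on the ball `B(z₀, 1)`, the `z`-derivative
  being dominated by `2π L' e^{2π L' (‖z₀‖ + 1)} ‖p x‖` with `L' := max L 1`);
* has exponential type, `‖Φ z‖ ≤ ‖p‖₁ e^{2π L' ‖z‖}`, because `‖exp (-2π i z x)‖ ≤ e^{2π |x| ‖z‖}`
  and `p x = 0` unless `|x| ≤ L ≤ L'`;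
* restricts to Mathlib's Fourier transform on the real line, `Φ s = 𝓕 p s`
  (`Real.fourier_real_eq_integral_exp_smul`: `𝓕 p s = ∫ exp (-2π i x s) p x dx`).

It is the `d = 1` analogue of `…Invisibility.stub_sliceEntire` (skeleton VIII, file
`ThreeConeCertificateExactCertificateInvisibilitySlice.lean`): the same proof with the first
coordinate `v 0` of `v : ℝ³` replaced by `x : ℝ` and `‖v‖` by `|x|`.  Pure Mathlib
(`Complex.norm_exp`, `Complex.re_le_norm`, `MeasureTheory.Integrable.mono'`,
`norm_integral_le_integral_norm`, `integral_mono`, `integral_const_mul`); private helper lemmas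
only, no named facts.  All `[folklore]`.
-/

noncomputable section

namespace Summit.AtomisticToContinuum.Crystallization.Theorems.ThreeConeCertificateExactCertificate.FarEqual

open MeasureTheory
open scoped FourierTransform RealInnerProductSpace Real

/-- `‖exp (a z i)‖ ≤ e^{L' ‖z‖}` for a real coefficient `a` with `|a| ≤ L'`
(`‖exp w‖ = e^{re w} ≤ e^{‖w‖}` and `‖a z i‖ = |a| ‖z‖`). [folklore] -/
private theorem norm_cexp_ofReal_mul_mul_I_le {a L' : ℝ} (ha : |a| ≤ L') (z : ℂ) :
    ‖Complex.exp ((a : ℂ) * z * Complex.I)‖ ≤ Real.exp (L' * ‖z‖) := by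
  rw [Complex.norm_exp]
  refine Real.exp_le_exp.2 ((Complex.re_le_norm _).trans ?_)
  rw [norm_mul, norm_mul, Complex.norm_real, Complex.norm_I, mul_one, Real.norm_eq_abs]
  exact mul_le_mul_of_nonneg_right ha (norm_nonneg _)

/-- The phase coefficient is controlled by the support radius: `|-2π x| ≤ 2π L'` whenever
`|x| ≤ L'`. [folklore] -/
private theorem abs_coeff_le {x L' : ℝ} (hx : |x| ≤ L') : |(-2 * π * x)| ≤ 2 * π * L' := by
  calc |(-2 * π * x)| = 2 * π * |x| := by
        rw [abs_mul, abs_mul, abs_neg, abs_two, abs_of_pos Real.pi_pos]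
    _ ≤ 2 * π * L' := by
        gcongr

/-- Pointwise bound on the Fourier–Laplace integrand: `‖exp (-2π i z x) p x‖ ≤ e^{2π L' ‖z‖} ‖p x‖`
with `L' = max L 1`, using `p x = 0` off `[-L, L]`. [folklore] -/
private theorem norm_integrand_le {p : ℝ → ℂ} {L : ℝ} (hsupp : ∀ x : ℝ, L < |x| → p x = 0)
    (z : ℂ) (x : ℝ) :
    ‖Complex.exp (((-2 * π * x : ℝ) : ℂ) * z * Complex.I) * p x‖ ≤
      Real.exp (2 * π * max L 1 * ‖z‖) * ‖p x‖ := by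
  by_cases hx : L < |x|
  · simp [hsupp x hx]
  · rw [norm_mul]
    have hxL : |x| ≤ max L 1 := (le_of_not_gt hx).trans (le_max_left _ _)
    exact mul_le_mul_of_nonneg_right (norm_cexp_ofReal_mul_mul_I_le (abs_coeff_le hxL) z)
      (norm_nonneg _)

/-- Pointwise bound on the `z`-derivative of the Fourier–Laplace integrand:
`‖exp (-2π i z x) (-2π i x) p x‖ ≤ 2π L' e^{2π L' ‖z‖} ‖p x‖`, `L' = max L 1`. [folklore] -/
private theorem norm_integrand_deriv_le {p : ℝ → ℂ} {L : ℝ}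
    (hsupp : ∀ x : ℝ, L < |x| → p x = 0) (z : ℂ) (x : ℝ) :
    ‖Complex.exp (((-2 * π * x : ℝ) : ℂ) * z * Complex.I) *
        (((-2 * π * x : ℝ) : ℂ) * Complex.I) * p x‖ ≤
      2 * π * max L 1 * Real.exp (2 * π * max L 1 * ‖z‖) * ‖p x‖ := by
  by_cases hx : L < |x|
  · simp [hsupp x hx]
  · have hxL : |x| ≤ max L 1 := (le_of_not_gt hx).trans (le_max_left _ _)
    have hc := abs_coeff_le hxL
    rw [norm_mul, norm_mul]
    refine mul_le_mul_of_nonneg_right ?_ (norm_nonneg _)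
    rw [mul_comm]
    refine mul_le_mul ?_ (norm_cexp_ofReal_mul_mul_I_le hc z) (norm_nonneg _) (by positivity)
    rw [norm_mul, Complex.norm_real, Complex.norm_I, mul_one, Real.norm_eq_abs]
    exact hc

/-- The Fourier–Laplace integrand `x ↦ exp (-2π i z x) p x` is a.e.-strongly measurable
(continuous phase times the integrable `p`). [folklore] -/
private theorem aestronglyMeasurable_integrand {p : ℝ → ℂ} (hp : Integrable p) (z : ℂ) :
    AEStronglyMeasurable (fun x : ℝ =>
      Complex.exp (((-2 * π * x : ℝ) : ℂ) * z * Complex.I) * p x) volume := by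
  have hc : Continuous fun x : ℝ => Complex.exp (((-2 * π * x : ℝ) : ℂ) * z * Complex.I) := by
    fun_prop
  exact hc.aestronglyMeasurable.mul hp.aestronglyMeasurable

/-- The `z`-derivative `x ↦ exp (-2π i z x) (-2π i x) p x` of the Fourier–Laplace integrand is
a.e.-strongly measurable. [folklore] -/
private theorem aestronglyMeasurable_integrand_deriv {p : ℝ → ℂ} (hp : Integrable p) (z : ℂ) :
    AEStronglyMeasurable (fun x : ℝ =>
      Complex.exp (((-2 * π * x : ℝ) : ℂ) * z * Complex.I) *
        (((-2 * π * x : ℝ) : ℂ) * Complex.I) * p x) volume := by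
  have hc : Continuous fun x : ℝ =>
      Complex.exp (((-2 * π * x : ℝ) : ℂ) * z * Complex.I) *
        (((-2 * π * x : ℝ) : ℂ) * Complex.I) := by
    fun_prop
  exact hc.aestronglyMeasurable.mul hp.aestronglyMeasurable

/-- The Fourier–Laplace integrand is integrable for every `z` (dominated by
`e^{2π L' ‖z‖} ‖p x‖`). [folklore] -/
private theorem integrable_integrand {p : ℝ → ℂ} {L : ℝ} (hp : Integrable p)
    (hsupp : ∀ x : ℝ, L < |x| → p x = 0) (z : ℂ) :
    Integrable (fun x : ℝ => Complex.exp (((-2 * π * x : ℝ) : ℂ) * z * Complex.I) * p x) :=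
  Integrable.mono' (hp.norm.const_mul (Real.exp (2 * π * max L 1 * ‖z‖)))
    (aestronglyMeasurable_integrand hp z) (ae_of_all _ fun x => norm_integrand_le hsupp z x)

/-- Differentiation under the integral sign: the Fourier–Laplace integral
`z ↦ ∫ exp (-2π i z x) p x dx` is complex-differentiable at every `z₀`, with derivative the
integral of the `z`-derivative of the integrand
(`hasDerivAt_integral_of_dominated_loc_of_deriv_le` on the ball `B(z₀, 1)`). [folklore] -/
private theorem hasDerivAt_laplaceIntegral {p : ℝ → ℂ} {L : ℝ} (hp : Integrable p)
    (hsupp : ∀ x : ℝ, L < |x| → p x = 0) (z₀ : ℂ) :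
    HasDerivAt (fun z : ℂ => ∫ x : ℝ, Complex.exp (((-2 * π * x : ℝ) : ℂ) * z * Complex.I) * p x)
      (∫ x : ℝ, Complex.exp (((-2 * π * x : ℝ) : ℂ) * z₀ * Complex.I) *
          (((-2 * π * x : ℝ) : ℂ) * Complex.I) * p x) z₀ := by
  have key := hasDerivAt_integral_of_dominated_loc_of_deriv_le (μ := volume) (𝕜 := ℂ)
    (F := fun (z : ℂ) (x : ℝ) => Complex.exp (((-2 * π * x : ℝ) : ℂ) * z * Complex.I) * p x)
    (F' := fun (z : ℂ) (x : ℝ) =>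
      Complex.exp (((-2 * π * x : ℝ) : ℂ) * z * Complex.I) *
        (((-2 * π * x : ℝ) : ℂ) * Complex.I) * p x)
    (x₀ := z₀) (s := Metric.ball z₀ 1)
    (bound := fun x => 2 * π * max L 1 * Real.exp (2 * π * max L 1 * (‖z₀‖ + 1)) * ‖p x‖)
    (Metric.ball_mem_nhds z₀ one_pos) ?_ ?_ ?_ ?_ ?_ ?_
  · exact key.2
  · exact Filter.Eventually.of_forall fun z => aestronglyMeasurable_integrand hp z
  · exact integrable_integrand hp hsupp z₀
  · exact aestronglyMeasurable_integrand_deriv hp z₀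
  · refine ae_of_all _ fun x z hz => (norm_integrand_deriv_le hsupp z x).trans ?_
    have hz' : ‖z‖ ≤ ‖z₀‖ + 1 := by
      rw [Metric.mem_ball, dist_eq_norm] at hz
      calc ‖z‖ = ‖(z - z₀) + z₀‖ := by rw [sub_add_cancel]
        _ ≤ ‖z - z₀‖ + ‖z₀‖ := norm_add_le _ _
        _ ≤ ‖z₀‖ + 1 := by linarith
    gcongr
  · exact hp.norm.const_mul _
  · refine ae_of_all _ fun x z _ => ?_
    have h := ((((hasDerivAt_id' z).const_mul ((-2 * π * x : ℝ) : ℂ)).mul_const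
      Complex.I).cexp).mul_const (p x)
    simpa only [mul_one] using h

/-- **Stub F0 (1-D Paley–Wiener, easy half).**  For an integrable `p : ℝ → ℂ` vanishing off
`[-L, L]`, the Fourier transform `𝓕 p` extends to an entire function `Φ` of exponential type:
`Φ z = ∫ p x e^{-2π i z x} dx`, `‖Φ z‖ ≤ ‖p‖₁ e^{2π (max L 1) ‖z‖}`, and `Φ s = 𝓕 p s` for real
`s` (`Real.fourier_real_eq_integral_exp_smul`). [folklore] -/
theorem stub_fourierEntireReal : ∀ (p : ℝ → ℂ) (L : ℝ), MeasureTheory.Integrable p → (∀ x : ℝ, L < |x| → p x = 0) →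
      ∃ Φ : ℂ → ℂ, Differentiable ℂ Φ ∧ (∃ B τ : ℝ, ∀ z : ℂ, ‖Φ z‖ ≤ B * Real.exp (τ * ‖z‖)) ∧
        ∀ s : ℝ, Φ (s : ℂ) = 𝓕 p s := by
  intro p L hp hsupp
  refine ⟨fun z : ℂ => ∫ x : ℝ, Complex.exp (((-2 * π * x : ℝ) : ℂ) * z * Complex.I) * p x,
    ?_, ?_, ?_⟩
  · -- entire: differentiate under the integral sign at every point
    exact fun z => (hasDerivAt_laplaceIntegral hp hsupp z).differentiableAt
  · -- exponential type `‖Φ z‖ ≤ ‖p‖₁ e^{2π L' ‖z‖}`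
    refine ⟨∫ x, ‖p x‖, 2 * π * max L 1, fun z => ?_⟩
    calc ‖∫ x : ℝ, Complex.exp (((-2 * π * x : ℝ) : ℂ) * z * Complex.I) * p x‖
        ≤ ∫ x : ℝ, ‖Complex.exp (((-2 * π * x : ℝ) : ℂ) * z * Complex.I) * p x‖ :=
          norm_integral_le_integral_norm _
      _ ≤ ∫ x : ℝ, Real.exp (2 * π * max L 1 * ‖z‖) * ‖p x‖ :=
          integral_mono (integrable_integrand hp hsupp z).norm (hp.norm.const_mul _)
            fun x => norm_integrand_le hsupp z x
      _ = (∫ x, ‖p x‖) * Real.exp (2 * π * max L 1 * ‖z‖) := by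
          rw [integral_const_mul, mul_comm]
  · -- real restriction: Mathlib's `𝓕 p s = ∫ exp (-2π i x s) p x dx` on the real line
    intro s
    rw [Real.fourier_real_eq_integral_exp_smul]
    refine integral_congr_ae (ae_of_all _ fun x => ?_)
    have hexp : ((-2 * π * x : ℝ) : ℂ) * (s : ℂ) * Complex.I =
        ((-2 * π * x * s : ℝ) : ℂ) * Complex.I := by
      push_cast
      ring
    simp only [smul_eq_mul, hexp]

end Summit.AtomisticToContinuum.Crystallization.Theorems.ThreeConeCertificateExactCertificate.FarEqual
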